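import Summits.Parity.GeneralizedHardyLittlewood.Theorems.PrimeLevelFamEdgeMomentsBeyondDiagonalDiagDecorShiftedP2Lpow
import HarnessLib

/-!
# Route `PrimeLevelFamEdge`, crux K_A `MomentsBeyondDiagonal` (stmt-Parity-20007), line «petersson_layers» v4, stub `stub_diag`:
# **the POLYNOMIAL PART of the order-`(1,1)` target:
# `Sel(ττ·[L³/24 + (e₀₀/4)L² + e₀₁L + e₁₁] − ττ(P₂(k₁)+P₂(k₂))·[L/8 + e₀₀/4]) = (π²/6)²·(Φ₃/24 − Ψ₁/4) + O(1/log M)`**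

Census R3(ii) — item 2 of `Cruxes/MomentsBeyondDiagonal/Lines/petersson_layers_stub_diag_g10_blocks.md`. By the weight algebra
of `…DiagDecorWeightOneOne` (p824224) and `…DiagBoseMixedStructure.bose_coeff_structure` (`Π₀₀ = L/2 + E₀₀`, `Π₀₁ = −L²/8 + E₀₁`,
`Π₁₁ = L³/24 − 2μ₂L + E₁₁`) the polynomial part of the order-`(1,1)` weight after the Hecke summation is
`ττ·[L³/24 + (E₀₀/4)L² + (E₀₁−2μ₂)L + E₁₁] − ττ(P₂(k₁)+P₂(k₂))·[L/8 + E₀₀/4]`, `L = 2λlog M − 2log g − log k₁ − log k₂`.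
Here the constants are arbitrary reals `e₀₀, e₀₁, e₁₁` and the two monomial families are evaluated by
`…DiagDecorShiftedLpow.abs_selbergLpow_sub_le` (`m = 3,2,1,0`) and `…DiagDecorShiftedP2Lpow.abs_selbergP2Lpow_sub_le(')` (`m = 1,0`):

* `selbergProd_add`, `selbergProd_sub` — binary additivity of the product-form Selberg sum;
* `orderOneOne_combine` — the real-variable bookkeeping of the eight pieces;
* `abs_selbergOrderOneOnePoly_sub_le` — **the displayed asymptotic**, main constant `(π²/6)²(Φ₃(λ,P)/24 − Ψ₁(λ,P)/4)` with
  `Φ₃ = Σ_{j≤3}Σ_{i≤j}C(3,j)C(j,i)2^{3−j}∫₀¹(λ−u)^{3−j}(u^iP)″(u^{j−i}P)″`, `Ψ₁ = Σ_{j≤1}Σ_{i≤j}C(1,j)C(j,i)2^{1−j}∫₀¹(λ−u)^{1−j}(−2u^iP)(u^{j−i}P)″`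
  (hand evaluation, item 3 of the remaining list: `Φ₃/24 − Ψ₁/4 = λ³∫P″²/3 + λ²P′(1)² + 2λP(1)P′(1) + P(1)² = 2τ₁₁λ²`,
  `τ₁₁ = ½[(P′(1)+Δ′P(1))² + ∫P″²/(3Δ′)]`, `λ = 1/Δ′`).

Def-free; theorems only. Helper `--supports stmt-Parity-20007`; closes nothing; K_A, K_B and the Parity summit are NOT
proved; nothing about Landau–Siegel zeros.

## References
* E. Kowalski, P. Michel, J. VanderKam, J. reine angew. Math. 526 (2000), (23)–(28) pp. 13–15 and Prop. 5.1 p. 18.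
  [cite: KowalskiMichelVanderKam2000, (23)–(28) — derivation (order-(1,1) piece of the diagonal main term, general Q)]
-/

noncomputable section

open scoped Real ArithmeticFunction.Moebius
open Finset ArithmeticFunction Polynomial MeasureTheory intervalIntegral

namespace Summit.Parity.GeneralizedHardyLittlewood.Theorems.MomentsBeyondDiagonal.DiagKernel

open Literature.NumberTheory.LFunctions Literature.NumberTheory.LFunctions.KMV2000
open MollifierMainTerm (W)
open Literature.NumberTheory.Sieve (one_le_log_of_three_le)

/-! ### Binary additivity -/

/-- `Sel(F + G) = Sel(F) + Sel(G)` for the product-form Selberg sum. [folklore] -/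
theorem selbergProd_add (P : ℝ[X]) (M : ℝ) (F G : ℕ → ℕ → ℕ → ℕ → ℝ) :
    ∑ c ∈ Icc 1 ⌊M⌋₊, ∑ g ∈ Icc 1 (⌊M⌋₊ / c), (μ g : ℝ) * c *
        ∑ k₁ ∈ Icc 1 (⌊M⌋₊ / (c * g)), ∑ k₂ ∈ Icc 1 (⌊M⌋₊ / (c * g)),
          ((μ (c * g * k₁) : ℝ) * ((psi (c * g * k₁))⁻¹ *
              P.eval (Real.log (M / ((c * g * k₁ : ℕ) : ℝ)) / Real.log M))) / ((c * g * k₁ : ℕ) : ℝ) *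
            (((μ (c * g * k₂) : ℝ) * ((psi (c * g * k₂))⁻¹ *
              P.eval (Real.log (M / ((c * g * k₂ : ℕ) : ℝ)) / Real.log M))) / ((c * g * k₂ : ℕ) : ℝ)) *
            (F c g k₁ k₂ + G c g k₁ k₂) =
      ∑ c ∈ Icc 1 ⌊M⌋₊, ∑ g ∈ Icc 1 (⌊M⌋₊ / c), (μ g : ℝ) * c *
        ∑ k₁ ∈ Icc 1 (⌊M⌋₊ / (c * g)), ∑ k₂ ∈ Icc 1 (⌊M⌋₊ / (c * g)),
          ((μ (c * g * k₁) : ℝ) * ((psi (c * g * k₁))⁻¹ *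
              P.eval (Real.log (M / ((c * g * k₁ : ℕ) : ℝ)) / Real.log M))) / ((c * g * k₁ : ℕ) : ℝ) *
            (((μ (c * g * k₂) : ℝ) * ((psi (c * g * k₂))⁻¹ *
              P.eval (Real.log (M / ((c * g * k₂ : ℕ) : ℝ)) / Real.log M))) / ((c * g * k₂ : ℕ) : ℝ)) *
            F c g k₁ k₂ +
      ∑ c ∈ Icc 1 ⌊M⌋₊, ∑ g ∈ Icc 1 (⌊M⌋₊ / c), (μ g : ℝ) * c *
        ∑ k₁ ∈ Icc 1 (⌊M⌋₊ / (c * g)), ∑ k₂ ∈ Icc 1 (⌊M⌋₊ / (c * g)),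
          ((μ (c * g * k₁) : ℝ) * ((psi (c * g * k₁))⁻¹ *
              P.eval (Real.log (M / ((c * g * k₁ : ℕ) : ℝ)) / Real.log M))) / ((c * g * k₁ : ℕ) : ℝ) *
            (((μ (c * g * k₂) : ℝ) * ((psi (c * g * k₂))⁻¹ *
              P.eval (Real.log (M / ((c * g * k₂ : ℕ) : ℝ)) / Real.log M))) / ((c * g * k₂ : ℕ) : ℝ)) *
            G c g k₁ k₂ := by
  simp only [mul_add, Finset.sum_add_distrib]

/-- `Sel(F − G) = Sel(F) − Sel(G)` for the product-form Selberg sum. [folklore] -/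
theorem selbergProd_sub (P : ℝ[X]) (M : ℝ) (F G : ℕ → ℕ → ℕ → ℕ → ℝ) :
    ∑ c ∈ Icc 1 ⌊M⌋₊, ∑ g ∈ Icc 1 (⌊M⌋₊ / c), (μ g : ℝ) * c *
        ∑ k₁ ∈ Icc 1 (⌊M⌋₊ / (c * g)), ∑ k₂ ∈ Icc 1 (⌊M⌋₊ / (c * g)),
          ((μ (c * g * k₁) : ℝ) * ((psi (c * g * k₁))⁻¹ *
              P.eval (Real.log (M / ((c * g * k₁ : ℕ) : ℝ)) / Real.log M))) / ((c * g * k₁ : ℕ) : ℝ) *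
            (((μ (c * g * k₂) : ℝ) * ((psi (c * g * k₂))⁻¹ *
              P.eval (Real.log (M / ((c * g * k₂ : ℕ) : ℝ)) / Real.log M))) / ((c * g * k₂ : ℕ) : ℝ)) *
            (F c g k₁ k₂ - G c g k₁ k₂) =
      ∑ c ∈ Icc 1 ⌊M⌋₊, ∑ g ∈ Icc 1 (⌊M⌋₊ / c), (μ g : ℝ) * c *
        ∑ k₁ ∈ Icc 1 (⌊M⌋₊ / (c * g)), ∑ k₂ ∈ Icc 1 (⌊M⌋₊ / (c * g)),
          ((μ (c * g * k₁) : ℝ) * ((psi (c * g * k₁))⁻¹ *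
              P.eval (Real.log (M / ((c * g * k₁ : ℕ) : ℝ)) / Real.log M))) / ((c * g * k₁ : ℕ) : ℝ) *
            (((μ (c * g * k₂) : ℝ) * ((psi (c * g * k₂))⁻¹ *
              P.eval (Real.log (M / ((c * g * k₂ : ℕ) : ℝ)) / Real.log M))) / ((c * g * k₂ : ℕ) : ℝ)) *
            F c g k₁ k₂ -
      ∑ c ∈ Icc 1 ⌊M⌋₊, ∑ g ∈ Icc 1 (⌊M⌋₊ / c), (μ g : ℝ) * c *
        ∑ k₁ ∈ Icc 1 (⌊M⌋₊ / (c * g)), ∑ k₂ ∈ Icc 1 (⌊M⌋₊ / (c * g)),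
          ((μ (c * g * k₁) : ℝ) * ((psi (c * g * k₁))⁻¹ *
              P.eval (Real.log (M / ((c * g * k₁ : ℕ) : ℝ)) / Real.log M))) / ((c * g * k₁ : ℕ) : ℝ) *
            (((μ (c * g * k₂) : ℝ) * ((psi (c * g * k₂))⁻¹ *
              P.eval (Real.log (M / ((c * g * k₂ : ℕ) : ℝ)) / Real.log M))) / ((c * g * k₂ : ℕ) : ℝ)) *
            G c g k₁ k₂ := by
  simp only [mul_sub, Finset.sum_sub_distrib]

/-! ### Real-variable bookkeeping of the eight pieces -/

/-- A crude-size extraction: `|S − m| ≤ c`, `|m| ≤ a/ℓ`, `c ≤ b/ℓ` give `|S| ≤ (a + b)/ℓ`. [folklore] -/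
private theorem abs_le_of_abs_sub_le {S m c a b ℓ : ℝ} (h : |S - m| ≤ c) (hm : |m| ≤ a / ℓ) (hc : c ≤ b / ℓ) :
    |S| ≤ (a + b) / ℓ := by
  have := abs_sub_abs_le_abs_sub S m
  rw [add_div]
  linarith

/-- **The bookkeeping of the eight pieces** (`K = (π²/6)²`, `ℓ = log M ≥ 1`). [folklore] -/
theorem orderOneOne_combine {S₃ S₂ S₁ S₀ T₁ T₁' T₀ T₀' Φ₃ Φ₂ Φ₁ Φ₀ Ψ₁ Ψ₀ e₀₀ e₀₁ e₁₁ ℓ K C₃ C₂ C₁ C₀ D₁ D₁' D₀ D₀' : ℝ}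
    (hℓ : 1 ≤ ℓ) (hK : 0 ≤ K) (hC₂ : 0 ≤ C₂) (hC₁ : 0 ≤ C₁) (hC₀ : 0 ≤ C₀) (hD₀ : 0 ≤ D₀) (hD₀' : 0 ≤ D₀')
    (h3 : |S₃ - K * Φ₃ * ℓ ^ 3 * ℓ / ℓ ^ 4| ≤ C₃ * ℓ ^ 3 / ℓ ^ 4)
    (h2 : |S₂ - K * Φ₂ * ℓ ^ 2 * ℓ / ℓ ^ 4| ≤ C₂ * ℓ ^ 2 / ℓ ^ 4)
    (h1 : |S₁ - K * Φ₁ * ℓ ^ 1 * ℓ / ℓ ^ 4| ≤ C₁ * ℓ ^ 1 / ℓ ^ 4)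
    (h0 : |S₀ - K * Φ₀ * ℓ ^ 0 * ℓ / ℓ ^ 4| ≤ C₀ * ℓ ^ 0 / ℓ ^ 4)
    (g1 : |T₁ - K * Ψ₁ * ℓ ^ 1 * ℓ / ℓ ^ 2| ≤ D₁ * ℓ ^ 1 / ℓ ^ 2)
    (g1' : |T₁' - K * Ψ₁ * ℓ ^ 1 * ℓ / ℓ ^ 2| ≤ D₁' * ℓ ^ 1 / ℓ ^ 2)
    (g0 : |T₀ - K * Ψ₀ * ℓ ^ 0 * ℓ / ℓ ^ 2| ≤ D₀ * ℓ ^ 0 / ℓ ^ 2)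
    (g0' : |T₀' - K * Ψ₀ * ℓ ^ 0 * ℓ / ℓ ^ 2| ≤ D₀' * ℓ ^ 0 / ℓ ^ 2) :
    |(1 / 24 * S₃ + e₀₀ / 4 * S₂ + e₀₁ * S₁ + e₁₁ * S₀ - 1 / 8 * T₁ - 1 / 8 * T₁' - e₀₀ / 4 * T₀ - e₀₀ / 4 * T₀') -
        K * (Φ₃ / 24 - Ψ₁ / 4)| ≤
      (C₃ / 24 + |e₀₀| / 4 * (K * |Φ₂| + C₂) + |e₀₁| * (K * |Φ₁| + C₁) + |e₁₁| * (K * |Φ₀| + C₀) +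
        (D₁ + D₁') / 8 + |e₀₀| / 4 * ((K * |Ψ₀| + D₀) + (K * |Ψ₀| + D₀'))) / ℓ := by
  have hℓ0 : 0 < ℓ := by linarith
  have hℓ1 : 1 / ℓ ^ 2 ≤ 1 / ℓ := one_div_le_one_div_of_le hℓ0 (le_self_pow₀ hℓ (by norm_num))
  have hℓ2 : 1 / ℓ ^ 3 ≤ 1 / ℓ := one_div_le_one_div_of_le hℓ0 (le_self_pow₀ hℓ (by norm_num))
  have hℓ3 : 1 / ℓ ^ 4 ≤ 1 / ℓ := one_div_le_one_div_of_le hℓ0 (le_self_pow₀ hℓ (by norm_num))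
  -- normalise the eight hypotheses
  have e3 : K * Φ₃ * ℓ ^ 3 * ℓ / ℓ ^ 4 = K * Φ₃ := by field_simp
  have e3' : C₃ * ℓ ^ 3 / ℓ ^ 4 = C₃ / ℓ := by field_simp
  rw [e3, e3'] at h3
  have e1 : K * Ψ₁ * ℓ ^ 1 * ℓ / ℓ ^ 2 = K * Ψ₁ := by field_simp
  have e1' : ∀ D : ℝ, D * ℓ ^ 1 / ℓ ^ 2 = D / ℓ := fun D ↦ by field_simp
  rw [e1, e1'] at g1 g1'
  have hS₂ : |S₂| ≤ (K * |Φ₂| + C₂) / ℓ := by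
    refine abs_le_of_abs_sub_le h2 ?_ ?_
    · rw [show K * Φ₂ * ℓ ^ 2 * ℓ / ℓ ^ 4 = K * Φ₂ * (1 / ℓ) by field_simp, abs_mul, abs_mul, abs_of_nonneg hK,
        abs_of_pos (by positivity : (0 : ℝ) < 1 / ℓ), ← mul_div_assoc, mul_one]
    · rw [show C₂ * ℓ ^ 2 / ℓ ^ 4 = C₂ * (1 / ℓ ^ 2) by field_simp, div_eq_mul_one_div C₂ ℓ]
      exact mul_le_mul_of_nonneg_left hℓ1 hC₂
  have hS₁ : |S₁| ≤ (K * |Φ₁| + C₁) / ℓ := by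
    refine abs_le_of_abs_sub_le h1 ?_ ?_
    · rw [show K * Φ₁ * ℓ ^ 1 * ℓ / ℓ ^ 4 = K * Φ₁ * (1 / ℓ ^ 2) by field_simp, abs_mul, abs_mul, abs_of_nonneg hK,
        abs_of_pos (by positivity : (0 : ℝ) < 1 / ℓ ^ 2), div_eq_mul_one_div _ ℓ]
      exact mul_le_mul_of_nonneg_left hℓ1 (by positivity)
    · rw [show C₁ * ℓ ^ 1 / ℓ ^ 4 = C₁ * (1 / ℓ ^ 3) by field_simp, div_eq_mul_one_div C₁ ℓ]
      exact mul_le_mul_of_nonneg_left hℓ2 hC₁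
  have hS₀ : |S₀| ≤ (K * |Φ₀| + C₀) / ℓ := by
    refine abs_le_of_abs_sub_le h0 ?_ ?_
    · rw [show K * Φ₀ * ℓ ^ 0 * ℓ / ℓ ^ 4 = K * Φ₀ * (1 / ℓ ^ 3) by field_simp, abs_mul, abs_mul, abs_of_nonneg hK,
        abs_of_pos (by positivity : (0 : ℝ) < 1 / ℓ ^ 3), div_eq_mul_one_div _ ℓ]
      exact mul_le_mul_of_nonneg_left hℓ2 (by positivity)
    · rw [show C₀ * ℓ ^ 0 / ℓ ^ 4 = C₀ * (1 / ℓ ^ 4) by field_simp, div_eq_mul_one_div C₀ ℓ]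
      exact mul_le_mul_of_nonneg_left hℓ3 hC₀
  have hT₀ : |T₀| ≤ (K * |Ψ₀| + D₀) / ℓ := by
    refine abs_le_of_abs_sub_le g0 ?_ ?_
    · rw [show K * Ψ₀ * ℓ ^ 0 * ℓ / ℓ ^ 2 = K * Ψ₀ * (1 / ℓ) by field_simp, abs_mul, abs_mul, abs_of_nonneg hK,
        abs_of_pos (by positivity : (0 : ℝ) < 1 / ℓ), ← mul_div_assoc, mul_one]
    · rw [show D₀ * ℓ ^ 0 / ℓ ^ 2 = D₀ * (1 / ℓ ^ 2) by field_simp, div_eq_mul_one_div D₀ ℓ]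
      exact mul_le_mul_of_nonneg_left hℓ1 hD₀
  have hT₀' : |T₀'| ≤ (K * |Ψ₀| + D₀') / ℓ := by
    refine abs_le_of_abs_sub_le g0' ?_ ?_
    · rw [show K * Ψ₀ * ℓ ^ 0 * ℓ / ℓ ^ 2 = K * Ψ₀ * (1 / ℓ) by field_simp, abs_mul, abs_mul, abs_of_nonneg hK,
        abs_of_pos (by positivity : (0 : ℝ) < 1 / ℓ), ← mul_div_assoc, mul_one]
    · rw [show D₀' * ℓ ^ 0 / ℓ ^ 2 = D₀' * (1 / ℓ ^ 2) by field_simp, div_eq_mul_one_div D₀' ℓ]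
      exact mul_le_mul_of_nonneg_left hℓ1 hD₀'
  -- regroup the target
  have hre : (1 / 24 * S₃ + e₀₀ / 4 * S₂ + e₀₁ * S₁ + e₁₁ * S₀ - 1 / 8 * T₁ - 1 / 8 * T₁' - e₀₀ / 4 * T₀ -
        e₀₀ / 4 * T₀') - K * (Φ₃ / 24 - Ψ₁ / 4) =
      1 / 24 * (S₃ - K * Φ₃) + e₀₀ / 4 * S₂ + e₀₁ * S₁ + e₁₁ * S₀ - 1 / 8 * (T₁ - K * Ψ₁) -
        1 / 8 * (T₁' - K * Ψ₁) - e₀₀ / 4 * T₀ - e₀₀ / 4 * T₀' := by ring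
  rw [hre]
  -- eight triangle inequalities
  have a1 : |1 / 24 * (S₃ - K * Φ₃)| ≤ C₃ / 24 / ℓ := by
    rw [abs_mul, abs_of_pos (by norm_num : (0 : ℝ) < 1 / 24)]
    calc 1 / 24 * |S₃ - K * Φ₃| ≤ 1 / 24 * (C₃ / ℓ) := by gcongr
      _ = C₃ / 24 / ℓ := by ring
  have a2 : |e₀₀ / 4 * S₂| ≤ |e₀₀| / 4 * (K * |Φ₂| + C₂) / ℓ := by
    rw [abs_mul, abs_div, abs_of_pos (by norm_num : (0 : ℝ) < 4), mul_div_assoc]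
    exact mul_le_mul_of_nonneg_left hS₂ (by positivity)
  have a3 : |e₀₁ * S₁| ≤ |e₀₁| * (K * |Φ₁| + C₁) / ℓ := by
    rw [abs_mul, mul_div_assoc]; exact mul_le_mul_of_nonneg_left hS₁ (abs_nonneg _)
  have a4 : |e₁₁ * S₀| ≤ |e₁₁| * (K * |Φ₀| + C₀) / ℓ := by
    rw [abs_mul, mul_div_assoc]; exact mul_le_mul_of_nonneg_left hS₀ (abs_nonneg _)
  have a5 : |1 / 8 * (T₁ - K * Ψ₁)| ≤ D₁ / 8 / ℓ := by
    rw [abs_mul, abs_of_pos (by norm_num : (0 : ℝ) < 1 / 8)]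
    calc 1 / 8 * |T₁ - K * Ψ₁| ≤ 1 / 8 * (D₁ / ℓ) := by gcongr
      _ = D₁ / 8 / ℓ := by ring
  have a6 : |1 / 8 * (T₁' - K * Ψ₁)| ≤ D₁' / 8 / ℓ := by
    rw [abs_mul, abs_of_pos (by norm_num : (0 : ℝ) < 1 / 8)]
    calc 1 / 8 * |T₁' - K * Ψ₁| ≤ 1 / 8 * (D₁' / ℓ) := by gcongr
      _ = D₁' / 8 / ℓ := by ring
  have a7 : |e₀₀ / 4 * T₀| ≤ |e₀₀| / 4 * (K * |Ψ₀| + D₀) / ℓ := by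
    rw [abs_mul, abs_div, abs_of_pos (by norm_num : (0 : ℝ) < 4), mul_div_assoc]
    exact mul_le_mul_of_nonneg_left hT₀ (by positivity)
  have a8 : |e₀₀ / 4 * T₀'| ≤ |e₀₀| / 4 * (K * |Ψ₀| + D₀') / ℓ := by
    rw [abs_mul, abs_div, abs_of_pos (by norm_num : (0 : ℝ) < 4), mul_div_assoc]
    exact mul_le_mul_of_nonneg_left hT₀' (by positivity)
  have htri : |1 / 24 * (S₃ - K * Φ₃) + e₀₀ / 4 * S₂ + e₀₁ * S₁ + e₁₁ * S₀ - 1 / 8 * (T₁ - K * Ψ₁) -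
        1 / 8 * (T₁' - K * Ψ₁) - e₀₀ / 4 * T₀ - e₀₀ / 4 * T₀'| ≤
      |1 / 24 * (S₃ - K * Φ₃)| + |e₀₀ / 4 * S₂| + |e₀₁ * S₁| + |e₁₁ * S₀| + |1 / 8 * (T₁ - K * Ψ₁)| +
        |1 / 8 * (T₁' - K * Ψ₁)| + |e₀₀ / 4 * T₀| + |e₀₀ / 4 * T₀'| := by
    have t1 := abs_add_le (1 / 24 * (S₃ - K * Φ₃) + e₀₀ / 4 * S₂ + e₀₁ * S₁ + e₁₁ * S₀ - 1 / 8 * (T₁ - K * Ψ₁) -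
        1 / 8 * (T₁' - K * Ψ₁) - e₀₀ / 4 * T₀) (-(e₀₀ / 4 * T₀'))
    have t2 := abs_add_le (1 / 24 * (S₃ - K * Φ₃) + e₀₀ / 4 * S₂ + e₀₁ * S₁ + e₁₁ * S₀ - 1 / 8 * (T₁ - K * Ψ₁) -
        1 / 8 * (T₁' - K * Ψ₁)) (-(e₀₀ / 4 * T₀))
    have t3 := abs_add_le (1 / 24 * (S₃ - K * Φ₃) + e₀₀ / 4 * S₂ + e₀₁ * S₁ + e₁₁ * S₀ - 1 / 8 * (T₁ - K * Ψ₁))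
        (-(1 / 8 * (T₁' - K * Ψ₁)))
    have t4 := abs_add_le (1 / 24 * (S₃ - K * Φ₃) + e₀₀ / 4 * S₂ + e₀₁ * S₁ + e₁₁ * S₀) (-(1 / 8 * (T₁ - K * Ψ₁)))
    have t5 := abs_add_le (1 / 24 * (S₃ - K * Φ₃) + e₀₀ / 4 * S₂ + e₀₁ * S₁) (e₁₁ * S₀)
    have t6 := abs_add_le (1 / 24 * (S₃ - K * Φ₃) + e₀₀ / 4 * S₂) (e₀₁ * S₁)
    have t7 := abs_add_le (1 / 24 * (S₃ - K * Φ₃)) (e₀₀ / 4 * S₂)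
    simp only [abs_neg, ← sub_eq_add_neg] at t1 t2 t3 t4
    linarith
  refine htri.trans ?_
  have hsum : |1 / 24 * (S₃ - K * Φ₃)| + |e₀₀ / 4 * S₂| + |e₀₁ * S₁| + |e₁₁ * S₀| + |1 / 8 * (T₁ - K * Ψ₁)| +
        |1 / 8 * (T₁' - K * Ψ₁)| + |e₀₀ / 4 * T₀| + |e₀₀ / 4 * T₀'| ≤
      C₃ / 24 / ℓ + |e₀₀| / 4 * (K * |Φ₂| + C₂) / ℓ + |e₀₁| * (K * |Φ₁| + C₁) / ℓ + |e₁₁| * (K * |Φ₀| + C₀) / ℓ +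
        D₁ / 8 / ℓ + D₁' / 8 / ℓ + |e₀₀| / 4 * (K * |Ψ₀| + D₀) / ℓ + |e₀₀| / 4 * (K * |Ψ₀| + D₀') / ℓ := by
    linarith
  refine hsum.trans (le_of_eq ?_)
  field_simp
  ring

/-! ### The polynomial part of the order-(1,1) target -/

/-- **THE POLYNOMIAL PART OF THE ORDER-`(1,1)` TARGET** (see the module docstring): for `0 ≤ λ ≤ 1`, `P₀ = P₁ = 0` and
arbitrary reals `e₀₀, e₀₁, e₁₁` there is `C` with, for all `M ≥ 3`,
`|Sel(ττ·[L³/24 + (e₀₀/4)L² + e₀₁L + e₁₁] − (1/8)ττ(P₂(k₁)+P₂(k₂))L − (e₀₀/4)ττ(P₂(k₁)+P₂(k₂))) − (π²/6)²(Φ₃/24 − Ψ₁/4)| ≤ C/log M`.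
[cite: KowalskiMichelVanderKam2000, (23)–(28) and Prop. 5.1 — derivation (order-(1,1) piece of the diagonal main term)] -/
theorem abs_selbergOrderOneOnePoly_sub_le (P : ℝ[X]) (hP0 : P.coeff 0 = 0) (hP1 : P.coeff 1 = 0)
    {lam : ℝ} (hlam0 : 0 ≤ lam) (hlam1 : lam ≤ 1) (e₀₀ e₀₁ e₁₁ : ℝ) :
    ∃ C : ℝ, 0 < C ∧ ∀ M : ℝ, 3 ≤ M →
      |∑ c ∈ Icc 1 ⌊M⌋₊, ∑ g ∈ Icc 1 (⌊M⌋₊ / c), (μ g : ℝ) * c *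
          ∑ k₁ ∈ Icc 1 (⌊M⌋₊ / (c * g)), ∑ k₂ ∈ Icc 1 (⌊M⌋₊ / (c * g)),
            ((μ (c * g * k₁) : ℝ) * ((psi (c * g * k₁))⁻¹ *
                P.eval (Real.log (M / ((c * g * k₁ : ℕ) : ℝ)) / Real.log M))) / ((c * g * k₁ : ℕ) : ℝ) *
              (((μ (c * g * k₂) : ℝ) * ((psi (c * g * k₂))⁻¹ *
                P.eval (Real.log (M / ((c * g * k₂ : ℕ) : ℝ)) / Real.log M))) / ((c * g * k₂ : ℕ) : ℝ)) *
              (1 / 24 * ((k₁.divisors.card : ℝ) * (k₂.divisors.card : ℝ) *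
                  (2 * (lam * Real.log M) - 2 * Real.log g - Real.log k₁ - Real.log k₂) ^ 3) +
                e₀₀ / 4 * ((k₁.divisors.card : ℝ) * (k₂.divisors.card : ℝ) *
                  (2 * (lam * Real.log M) - 2 * Real.log g - Real.log k₁ - Real.log k₂) ^ 2) +
                e₀₁ * ((k₁.divisors.card : ℝ) * (k₂.divisors.card : ℝ) *
                  (2 * (lam * Real.log M) - 2 * Real.log g - Real.log k₁ - Real.log k₂) ^ 1) +
                e₁₁ * ((k₁.divisors.card : ℝ) * (k₂.divisors.card : ℝ) *
                  (2 * (lam * Real.log M) - 2 * Real.log g - Real.log k₁ - Real.log k₂) ^ 0) -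
                1 / 8 * ((k₁.divisors.card : ℝ) * (∑ p ∈ k₁.primeFactors, Real.log p ^ 2) * (k₂.divisors.card : ℝ) *
                  (2 * (lam * Real.log M) - 2 * Real.log g - Real.log k₁ - Real.log k₂) ^ 1) -
                1 / 8 * ((k₁.divisors.card : ℝ) * ((k₂.divisors.card : ℝ) * ∑ p ∈ k₂.primeFactors, Real.log p ^ 2) *
                  (2 * (lam * Real.log M) - 2 * Real.log g - Real.log k₁ - Real.log k₂) ^ 1) -
                e₀₀ / 4 * ((k₁.divisors.card : ℝ) * (∑ p ∈ k₁.primeFactors, Real.log p ^ 2) * (k₂.divisors.card : ℝ) *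
                  (2 * (lam * Real.log M) - 2 * Real.log g - Real.log k₁ - Real.log k₂) ^ 0) -
                e₀₀ / 4 * ((k₁.divisors.card : ℝ) * ((k₂.divisors.card : ℝ) * ∑ p ∈ k₂.primeFactors, Real.log p ^ 2) *
                  (2 * (lam * Real.log M) - 2 * Real.log g - Real.log k₁ - Real.log k₂) ^ 0)) -
        (π ^ 2 / 6) ^ 2 * ((∑ j ∈ Finset.range (3 + 1), ∑ i ∈ Finset.range (j + 1),
            ((3 : ℕ).choose j : ℝ) * (j.choose i : ℝ) * 2 ^ (3 - j) *
              ∫ u in (0 : ℝ)..1, (((Polynomial.C lam - X) ^ (3 - j) * derivative (derivative (X ^ i * P))) *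
                derivative (derivative (X ^ (j - i) * P))).eval u) / 24 - (∑ j ∈ Finset.range (1 + 1), ∑ i ∈ Finset.range (j + 1),
            ((1 : ℕ).choose j : ℝ) * (j.choose i : ℝ) * 2 ^ (1 - j) *
              ∫ u in (0 : ℝ)..1, (((Polynomial.C lam - X) ^ (1 - j) * (-(2 : ℝ) • (X ^ i * P))) *
                derivative (derivative (X ^ (j - i) * P))).eval u) / 4)| ≤
        C / Real.log M := by
  obtain ⟨C₃, hC₃, h3⟩ := abs_selbergLpow_sub_le P hP0 hP1 3 hlam0 hlam1
  obtain ⟨C₂, hC₂, h2⟩ := abs_selbergLpow_sub_le P hP0 hP1 2 hlam0 hlam1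
  obtain ⟨C₁, hC₁, h1⟩ := abs_selbergLpow_sub_le P hP0 hP1 1 hlam0 hlam1
  obtain ⟨C₀, hC₀, h0⟩ := abs_selbergLpow_sub_le P hP0 hP1 0 hlam0 hlam1
  obtain ⟨D₁, hD₁, g1⟩ := abs_selbergP2Lpow_sub_le P hP0 hP1 1 hlam0 hlam1
  obtain ⟨D₁', hD₁', g1'⟩ := abs_selbergP2Lpow_sub_le' P hP0 hP1 1 hlam0 hlam1
  obtain ⟨D₀, hD₀, g0⟩ := abs_selbergP2Lpow_sub_le P hP0 hP1 0 hlam0 hlam1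
  obtain ⟨D₀', hD₀', g0'⟩ := abs_selbergP2Lpow_sub_le' P hP0 hP1 0 hlam0 hlam1
  have hK : 0 ≤ (π ^ 2 / 6 : ℝ) ^ 2 := by positivity
  refine ⟨?_, ?_, fun M hM ↦ ?_⟩
  rotate_left 2
  · have hℓ1 : 1 ≤ Real.log M := one_le_log_of_three_le hM
    simp only [selbergProd_add, selbergProd_sub, selbergProd_const_mul]
    exact orderOneOne_combine (e₀₀ := e₀₀) (e₀₁ := e₀₁) (e₁₁ := e₁₁) hℓ1 hK hC₂.le hC₁.le hC₀.le hD₀.le hD₀'.le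
      (h3 M hM) (h2 M hM) (h1 M hM) (h0 M hM) (g1 M hM) (g1' M hM) (g0 M hM) (g0' M hM)
  · positivity

end Summit.Parity.GeneralizedHardyLittlewood.Theorems.MomentsBeyondDiagonal.DiagKernel

end
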